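import Summits.BirchSwinnertonDyer.Rank1Residual.X1.GeneratorCountLayerZero
import Summits.BirchSwinnertonDyer.Rank1Residual.X1.GeneratorCountSqueezeFacts
import Summits.BirchSwinnertonDyer.Rank1Residual.Additive.BudgetFromTamagawaWitnesses
import Summits.BirchSwinnertonDyer.Rank1Residual.Additive.BudgetFromTamagawaCertificatesLayerNoTate
import Summits.BirchSwinnertonDyer.Rank1Residual.GaloisImage.PropagatedConditionCardEP
import HarnessLib

/-!
# Route M's generator COUNT from level-`0` classes, II (over `ℚ`): the typed input
# `GeneratorCountGE W p b` of `X1/GeneratorCountSqueeze.lean` from `p^b` classes of `A_0[p]`, and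
# `GeneratorCountGE W p #S` from `p ∣ c_v` on `S` — the Tamagawa part `t₀` of route T's count is a
# THEOREM (cell `b2b-bsdres`, unit `b2b-bsdres-eisenstein-p1`, gen 15; FILE 2 of 2)

HONEST FRAMING (run/shared/lean/b2b/bsd-rank1-residual/, verbatim in every file): the goal of the
cell is to DELETE the COMBINATION-SHAPED residual classes of the Birch–Swinnerton-Dyer formula for
ALL analytic-rank `≤ 1` elliptic curves over `ℚ` — "full BSD formula for every rank `≤ 1` curve in
class `C`" assembled STRICTLY from published theorems — so that the rank-`≤ 1` remainder becomes
exactly the CONSTRUCTION-SHAPED classes, which are TYPED (missing-input `Prop`s), NOT attempted.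
This is not "finishing BSD". Sub-cell `b2b-bsdres-eisenstein-p1` (CLASS-OWNERS row "X1 (r = 0)"):
research route; NO CLAIM BEYOND STATED CLASSES; nothing here changes a label; nothing is booked.
THEOREMS ONLY — no definition, no named fact, no typed input introduced; the named facts consumed are
PUBLISHED (Poitou–Tate duality for Selmer structures over `ℚ`; Wuthrich 2014 Thm. 16, Greenberg 1999
Thm. 4.1 / Prop. 3.10 / Prop. 4.15 (ii), modularity, Gross–Zagier–Kolyvagin), exactly the hypotheses
of the tree files this one composes; Tate's local Euler–Poincaré characteristic, a hypothesis `hEP`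
of n1011's budget files, is DISCHARGED over `ℚ` by the tree theorem
`GaloisImage.EP.forall_localEulerPoincareCharacteristic_adicCompletion` wherever this file can.

## What

* §3 **`generatorCountGE_of_layerZeroClasses`**: `E(ℚ)[p] = 0` and, for every cyclotomic `κ`,
  `p^b` classes in `A_0[p]` (`A_0 = h_0⁻¹(Sel_{p^∞}(E/ℚ_∞))`: classes over `ℚ` everywhere locally
  trivial over `ℚ_∞`) ⟹ `GeneratorCountGE W p b` (FILE 1's count). The hypothesis is literally the
  `hA` of n1011's `Additive.budgetLeLambdaAt_of_prop414_of_layerClasses`, which reads off `λ ≥ b`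
  at `μ = 0`; the count `#(X/𝔪X) ≥ p^b` needs no `μ = 0` and is what LEMMA M₀ consumes at `μ ≥ 1`
  members too. **`generatorCountGE_of_tamagawaWitnesses`** plugs in n1011's level-`0` budget door
  (`Additive.exists_finset_layerZero_of_tamagawaWitnesses`: Poitou–Tate pair counting of the
  Kummer structure relaxed to `H¹_ur + 𝓚_v` on `T₀`); **`generatorCountGE_of_dvd_localTamagawaNumber`:
  `p` odd, `p ∤ #E(ℚ)_tors`, `S` a finite set of places `v ∤ p` with `p ∣ c_v` ⟹
  `GeneratorCountGE W p #S`**, the witnesses being tree theorems (`p ∣ c_v` forces additive or split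
  multiplicative reduction; `Additive.…_of_hasAdditiveReductionAt`,
  `Additive.…_of_split_of_dvd_localTamagawaNumber` — Kodaira–Néron, no Tate uniformisation).
* §4 the leaf consumers of `X1/GeneratorCountSqueezeFacts.lean` with the count DISCHARGED:
  `Leaf.bsdp_of_muZero_of_tamagawaCount` (`μ = 0` member), `…_inter` (M₀ ∘ C shape),
  `Leaf.bsdp_of_muPartAt_of_tamagawaCount` (`μ ≥ 1` member); typed inputs left: the analytic
  Newton datum `AnalyticLamConstValDivisorSet`, `μ_an`/`λ_an` (resp. `MuPartAt`).

HONEST LIMIT (numbers, `HOME/b2b-bsdres-eisenstein-p1/routeM/routeM15tam.py`, X1R0-GAPMAP §24):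
with `B := t₀ = #S` at `δ = 0` members only, the census's M₀ closures are NOT reproduced (window
0/15, lane 0/2, `p = 3` beyond the window 4/411, `p ∈ {5, 7, 13}` beyond the window 0/54): they bind
with `B₀ = t₀ + a`, `a ∈ {1, 2}` the contribution of the anomalous prime `p` itself (GAPMAP §14.1
(c)–(d)), which is NOT discharged here; what this file gives today is a second, count-discharged
certificate on 1 159 class-rows already closed by route N. The `a`-part needs level-`0` classes
supported at `p`: FILE 3 (`X1/GeneratorCountAnomalous.lean`) gets `#S + 1` from ONE typed LOCAL
lemma (at an ANOMALOUS prime every class of `H¹(ℚ_p, E[p])` satisfies the `ℚ_∞`-local condition: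
Greenberg Prop. 2.4 / Lemma 3.4 and the triviality of `Ẽ[p]`), reproducing 69/482 of the M₀
closures (177/482 with `a = 2`); `generatorCountGE_of_layerZeroClasses` is the socket of both.

References: [GreenbergLNM1716] §1 p. 60, §3 pp. 85–88 (|ker r_v| = c_v^{(p)}), §4 p. 137, §5
pp. 114–118 (proof of Cor. 5.6: λ_E ≥ t); [MilneADT2006] Ch. I Thm. 2.8, Thm. 4.10;
[SilvermanATAEC1994] Cor. IV.9.2(d), IV.9.4 Step 2; [Wuthrich2014] Thm. 16; X1R0-GAPMAP §14.1, §22, §24.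
-/

noncomputable section

open scoped Classical

open WeierstrassCurve Literature.NumberTheory.EllipticCurves
  Literature.NumberTheory.EllipticCurves.IwasawaAlgebra IsLocalRing
  Summit.BirchSwinnertonDyer.Rank1Residual.X1.GeneratorCountLayerZero

set_option autoImplicit false

universe u

namespace Summit.BirchSwinnertonDyer.Rank1Residual.X1.GeneratorCountTamagawa

/-! ## §3. Over `ℚ`: the typed count `GeneratorCountGE` from level-`0` classes and from the tree's
Tamagawa witnesses -/

section Rat

open NumberField IsDedekindDomain Literature.NumberTheory.GaloisRepresentations
  Literature.NumberTheory.GaloisCohomology Literature.NumberTheory.EllipticCurves.Rank1Residual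
  Summit.BirchSwinnertonDyer.Rank1Residual.X1.GeneratorCountSqueeze
  Summit.BirchSwinnertonDyer.Rank1Residual.GaloisImage
open Literature.NumberTheory.GaloisRepresentations.DiscreteGaloisModule (unramifiedSubgroup)

variable {W : WeierstrassCurve ℚ} [W.IsElliptic] [W.IsGloballyMinimal] {p : ℕ} [hp : Fact p.Prime]

/-- **`GeneratorCountGE W p b` FROM LEVEL-`0` CLASSES.** If `E(ℚ)[p] = 0` and, for every cyclotomic
`κ`, `A_0[p]` contains `≥ p^b` classes (`A_0 = h_0⁻¹(Sel_{p^∞}(E/ℚ_∞))`: classes over `ℚ`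
everywhere locally trivial over `ℚ_∞`), then `p^b ≤ #(X/𝔪X)` for every torsion cyclotomic dual
datum — route M's typed count (`X1/GeneratorCountSqueeze.lean`) DISCHARGED from a level-`0` input.
The hypothesis `hA` is exactly the one of n1011's `Additive.budgetLeLambdaAt_of_prop414_of_layerClasses`
(which reads off `λ ≥ b` at `μ = 0`); the count `#(X/𝔪X) ≥ p^b` needs no `μ = 0` and is what
LEMMA M₀ (`X1/GeneratorBound.lean`) consumes at `μ ≥ 1` members too.
[cite: GreenbergLNM1716, §1 p. 60, §3 pp. 85–86, p. 137] -/
theorem generatorCountGE_of_layerZeroClasses (hK : ∀ P : W.toAffine.Point, p • P = 0 → P = 0)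
    {b : ℕ} (hA : ∀ κ : ZpExtension ℚ p, κ.IsCyclotomic →
      ∃ t : Finset {z : W.selmerInftyPreimage κ 0 // p • z = 0}, p ^ b ≤ t.card) :
    GeneratorCountGE W p b := by
  intro κ γ hκ _ _ D _ _
  obtain ⟨t, ht⟩ := hA κ hκ
  -- (`DecidableEq ℚ`: the instance of the statement over `ℚ` and the classical one of §2 differ;
  -- `convert` identifies them, as in n1011's `Additive.budgetLeLambdaAt_of_tamagawaWitnesses`)
  exact ht.trans (card_le_natCard_quotient_maximalIdeal_of_layerZeroClasses W κ D
    (fun P hP ↦ hK P (by convert hP)) t)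

/-- **`GeneratorCountGE W p #T₀` FROM TAMAGAWA WITNESSES** (n1011's level-`0` budget door
`Additive.exists_finset_layerZero_of_tamagawaWitnesses`: Poitou–Tate pair counting of the Kummer
structure relaxed to `H¹_ur + 𝓚_v` on `T₀` gives `p^{#T₀}` classes of `A_0[p]`): for `p` odd with
`p ∤ #E(ℚ)_tors` and a finite set `T₀` of places `v ∤ p` each carrying an unramified non-Kummer
class of `H¹(ℚ_v, E[p])`, `X(E/ℚ_∞)` needs at least `#T₀` generators. Named facts: Poitou–Tate
duality for Selmer structures over `ℚ` (`hPT`), the local Euler–Poincaré formula (`hEP`).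
[cite: GreenbergLNM1716, §5 pp. 114–118 (proof of Cor. 5.6) and p. 137] [cite: MilneADT2006, Ch. I Thm. 2.8 and Thm. 4.10] -/
theorem generatorCountGE_of_tamagawaWitnesses (hodd : p ≠ 2)
    (hPT : poitouTate_selmerStructure_duality ℚ)
    (hEP : ∀ v : HeightOneSpectrum (𝓞 ℚ), localEulerPoincareCharacteristic (v.adicCompletion ℚ))
    (htors : ¬ p ∣ W.torsionOrder)
    (T₀ : Finset (HeightOneSpectrum (𝓞 ℚ))) (hT₀p : ∀ v ∈ T₀, ((p : ℕ) : 𝓞 ℚ) ∉ v.asIdeal)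
    (hwit : ∀ v ∈ T₀, ∃ u ∈ unramifiedSubgroup
        ((W.torsionGaloisModule (p : ℤ)).restrictField (v.adicCompletion ℚ)) 1,
      u ∉ W.kummerLocalConditionAt (p : ℤ) (v.adicCompletion ℚ)) :
    GeneratorCountGE W p T₀.card := by
  haveI : NeZero p := ⟨hp.out.ne_zero⟩
  obtain ⟨inv, hperf, hsum, -, hcompl⟩ := hPT p
  have hK : ∀ P : W.toAffine.Point, p • P = 0 → P = 0 :=
    fun P hP ↦ Additive.forall_smul_eq_zero_of_not_dvd_torsionOrder W p htors P (by convert hP)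
  exact generatorCountGE_of_layerZeroClasses hK fun κ hκ ↦
    Additive.exists_finset_layerZero_of_tamagawaWitnesses W p hodd
      (fun P hP ↦ Additive.forall_smul_eq_zero_of_not_dvd_torsionOrder W p htors P (by convert hP))
      inv hperf hsum hcompl hEP T₀ hT₀p hwit κ hκ

/-- **`GeneratorCountGE W p #S` FROM `p ∣ c_v` ALONE** (the census column): for `p` odd with
`p ∤ #E(ℚ)_tors` and a finite set `S` of places `v ∤ p` with `p ∣ c_v(E)`, `X(E/ℚ_∞)` needs at
least `#S` generators over `Λ` for every torsion cyclotomic dual datum. The witnesses come from the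
tree, unconditionally: `p` odd and `p ∣ c_v` force additive or split multiplicative reduction
(`Additive.hasAdditiveReductionAt_or_hasSplitMultiplicativeReductionAt_of_dvd_localTamagawaNumber`),
and either kind carries an unramified non-Kummer class (`Additive.…_of_hasAdditiveReductionAt`,
`Additive.…_of_split_of_dvd_localTamagawaNumber` — Kodaira–Néron, no Tate uniformisation). This is
the `t₀` part of route T's §14.1 count `B = t₀ + a − 2δ` at `δ = 0`, IN THE KERNEL modulo ONE named
duality fact (Poitou–Tate for Selmer structures over `ℚ`, `hPT`); Tate's local Euler–Poincaré
characteristic is a tree THEOREM over `ℚ` (`GaloisImage.EP.forall_localEulerPoincareCharacteristic_adicCompletion`). [cite: GreenbergLNM1716, §3 p. 88 (|ker r_v| = c_v^{(p)}), §5 pp. 114–118, p. 137]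
[cite: SilvermanATAEC1994, Cor. IV.9.2(d) (PDF p. 340), IV.9.4 Step 2 (PDF p. 344)] -/
theorem generatorCountGE_of_dvd_localTamagawaNumber (hodd : p ≠ 2)
    (hPT : poitouTate_selmerStructure_duality ℚ)
    (htors : ¬ p ∣ W.torsionOrder) (S : Finset (HeightOneSpectrum (𝓞 ℚ)))
    (hSp : ∀ v ∈ S, ((p : ℕ) : 𝓞 ℚ) ∉ v.asIdeal)
    (hcv : ∀ v ∈ S,
      p ∣ (W.baseChange (v.adicCompletion ℚ)).localTamagawaNumber (v.adicCompletionIntegers ℚ)) :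
    GeneratorCountGE W p S.card :=
  generatorCountGE_of_tamagawaWitnesses hodd hPT (EP.forall_localEulerPoincareCharacteristic_adicCompletion ℚ)
    htors S hSp fun v hv ↦ by
    haveI : Finite (IsLocalRing.ResidueField (v.adicCompletionIntegers ℚ)) :=
      HeightOneSpectrum.finite_residueField_adicCompletionIntegers ℚ v
    rcases Additive.hasAdditiveReductionAt_or_hasSplitMultiplicativeReductionAt_of_dvd_localTamagawaNumber
        W v hodd (hcv v hv) with hadd | hsplit
    · exact Additive.exists_mem_unramifiedSubgroup_not_mem_kummerLocalConditionAt_of_hasAdditiveReductionAt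
        W p v (hSp v hv) hodd hadd (hcv v hv)
    · exact Additive.exists_mem_unramifiedSubgroup_not_mem_kummerLocalConditionAt_of_split_of_dvd_localTamagawaNumber
        W v hsplit (hSp v hv) (hcv v hv)

end Rat

/-! ## §4. On the leaf X1 ∩ {r = 0}: route M's closures with the count DISCHARGED at `δ = 0` members -/

section Leaf

open NumberField IsDedekindDomain Literature.NumberTheory.GaloisRepresentations
  Literature.NumberTheory.GaloisCohomology Literature.NumberTheory.EllipticCurves.Rank1Residual
  Literature.NumberTheory.EllipticCurves.ModularForms
  Literature.NumberTheory.EllipticCurves.Greenberg1999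
  Summit.BirchSwinnertonDyer.BirchSwinnertonDyer.Theorems.Rank1ResidualX1Defs
  Summit.BirchSwinnertonDyer.Rank1Residual.X1.MuLambda
  Summit.BirchSwinnertonDyer.Rank1Residual.X1.MuPart
  Summit.BirchSwinnertonDyer.Rank1Residual.X1.ParitySqueeze
  Summit.BirchSwinnertonDyer.Rank1Residual.X1.TamagawaSqueeze
  Summit.BirchSwinnertonDyer.Rank1Residual.X1.FactorSqueeze
  Summit.BirchSwinnertonDyer.Rank1Residual.X1.GeneratorSqueeze
  Summit.BirchSwinnertonDyer.Rank1Residual.X1.GeneratorCountSqueeze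
  Summit.BirchSwinnertonDyer.Rank1Residual.X1.GeneratorCountSqueezeFacts

variable {W : WeierstrassCurve ℚ} [W.IsElliptic] [W.IsGloballyMinimal] {p : ℕ} [hp : Fact p.Prime]

/-- **ROUTE M, COUNT DISCHARGED (μ = 0 member, `p ∤ #E(ℚ)_tors`): `μ_an = 0 ∧ λ_an = n ∧
(p ∣ c_v on S) ∧ (Newton data S') ∧ gap ⇒ BSD(E,p)` on the leaf X1 ∩ {r = 0}.** The typed count
`GeneratorCountGE W p #S` of `Leaf.bsdp_of_muZero_of_generatorCount_of_prop415` is now a THEOREM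
(`generatorCountGE_of_dvd_localTamagawaNumber`); what stays typed is the analytic Newton datum `S'`
(`AnalyticLamConstValDivisorSet`), `μ_an = 0` and `λ_an = n`. Named PUBLISHED facts: Wuthrich 2014
Thm. 16, Greenberg 1999 Thm. 4.1 / Prop. 3.10 / Prop. 4.15 (ii), modularity, Gross–Zagier–Kolyvagin,
Poitou–Tate duality over `ℚ` (Euler–Poincaré is a tree theorem). The gap check reads
`∀ (d,v) ∈ S', #S ≤ v → Even d → d ≤ n → n ≤ d + 1`.
[cite: GreenbergLNM1716, Prop. 3.10, Thm. 4.1, §5 pp. 114–118, p. 137] [cite: Wuthrich2014, Thm. 16 (p. 397)] -/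
theorem Leaf.bsdp_of_muZero_of_tamagawaCount
    (hW16 : Wuthrich2014.charIdeal_dvd_padicLFunction) (hGr : greenberg_charValue_rankZero)
    (h310 : prop310_selmerCorank_mod_two_eq_lambdaInvariant)
    (h415 : prop415ii_noFiniteSubmodule_of_ordinary_or_multiplicative)
    (hmod : nonempty_modularParametrizationData)
    (hGZK : rank_eq_analyticRank_of_analyticRank_le_one)
    (hPT : poitouTate_selmerStructure_duality ℚ)
    (hL : RankZero.Leaf W p) (htors : ¬ p ∣ W.torsionOrder) (hμ0 : AnalyticMuLE W p 0) {n : ℕ}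
    {S' : Set (ℕ × ℕ)} (hlam : AnalyticLambdaEq W p n) (S : Finset (HeightOneSpectrum (𝓞 ℚ)))
    (hSp : ∀ v ∈ S, ((p : ℕ) : 𝓞 ℚ) ∉ v.asIdeal)
    (hcv : ∀ v ∈ S,
      p ∣ (W.baseChange (v.adicCompletion ℚ)).localTamagawaNumber (v.adicCompletionIntegers ℚ))
    (hS : AnalyticLamConstValDivisorSet W p S')
    (hgap : ∀ d v, (d, v) ∈ S' → S.card ≤ v → Even d → d ≤ n → n ≤ d + 1) : BSDp W p :=
  Leaf.bsdp_of_muZero_of_generatorCount_of_prop415 hW16 hGr h310 h415 hmod hGZK hL hμ0 hlam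
    (generatorCountGE_of_dvd_localTamagawaNumber (isClassX1_of_classX1 hL.classX1).two_ne hPT
      htors S hSp hcv) hS hgap

/-- **The same intersected with a second membership certificate** (route C's cyclotomic factor,
route N, route D: the M₀ ∘ C shape), count discharged. [cite: GreenbergLNM1716, Prop. 3.10, Thm. 4.1,
§5 pp. 114–118, pp. 132, 137] [cite: Wuthrich2014, Thm. 16 (p. 397)] -/
theorem Leaf.bsdp_of_muZero_of_tamagawaCount_inter
    (hW16 : Wuthrich2014.charIdeal_dvd_padicLFunction) (hGr : greenberg_charValue_rankZero)
    (h310 : prop310_selmerCorank_mod_two_eq_lambdaInvariant)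
    (h415 : prop415ii_noFiniteSubmodule_of_ordinary_or_multiplicative)
    (hmod : nonempty_modularParametrizationData)
    (hGZK : rank_eq_analyticRank_of_analyticRank_le_one)
    (hPT : poitouTate_selmerStructure_duality ℚ)
    (hL : RankZero.Leaf W p) (htors : ¬ p ∣ W.torsionOrder) (hμ0 : AnalyticMuLE W p 0) {n : ℕ}
    {S' : Set (ℕ × ℕ)} {A' : Set ℕ} (hlam : AnalyticLambdaEq W p n)
    (S : Finset (HeightOneSpectrum (𝓞 ℚ))) (hSp : ∀ v ∈ S, ((p : ℕ) : 𝓞 ℚ) ∉ v.asIdeal)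
    (hcv : ∀ v ∈ S,
      p ∣ (W.baseChange (v.adicCompletion ℚ)).localTamagawaNumber (v.adicCompletionIntegers ℚ))
    (hS : AnalyticLamConstValDivisorSet W p S') (hA' : AlgebraicLambdaMem W p A')
    (hgap : ∀ d v, (d, v) ∈ S' → S.card ≤ v → d ∈ A' → Even d → d ≤ n → n ≤ d + 1) :
    BSDp W p :=
  Leaf.bsdp_of_muZero_of_generatorCount_inter_of_prop415 hW16 hGr h310 h415 hmod hGZK hL hμ0 hlam
    (generatorCountGE_of_dvd_localTamagawaNumber (isClassX1_of_classX1 hL.classX1).two_ne hPT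
      htors S hSp hcv) hS hA' hgap

/-- **ROUTE M at a `μ ≥ 1` member with `p ∤ #E(ℚ)_tors`, count discharged**: the μ-part
`MuPartAt W p` (route P / `X1/MuPart.lean`) in place of `μ_an = 0`. The census's second binding shape
(the `μ = 1` member of a `φ = 1` class has no rational `p`-torsion). [cite: GreenbergLNM1716, Prop. 3.10,
Thm. 4.1, §5 pp. 114–118, p. 137] [cite: Wuthrich2014, Thm. 16 (p. 397)] -/
theorem Leaf.bsdp_of_muPartAt_of_tamagawaCount
    (hW16 : Wuthrich2014.charIdeal_dvd_padicLFunction) (hGr : greenberg_charValue_rankZero)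
    (h310 : prop310_selmerCorank_mod_two_eq_lambdaInvariant)
    (h415 : prop415ii_noFiniteSubmodule_of_ordinary_or_multiplicative)
    (hmod : nonempty_modularParametrizationData)
    (hGZK : rank_eq_analyticRank_of_analyticRank_le_one)
    (hPT : poitouTate_selmerStructure_duality ℚ)
    (hL : RankZero.Leaf W p) (htors : ¬ p ∣ W.torsionOrder) (hμ : MuPartAt W p) {n : ℕ}
    {S' : Set (ℕ × ℕ)} (hlam : AnalyticLambdaEq W p n) (S : Finset (HeightOneSpectrum (𝓞 ℚ)))
    (hSp : ∀ v ∈ S, ((p : ℕ) : 𝓞 ℚ) ∉ v.asIdeal)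
    (hcv : ∀ v ∈ S,
      p ∣ (W.baseChange (v.adicCompletion ℚ)).localTamagawaNumber (v.adicCompletionIntegers ℚ))
    (hS : AnalyticLamConstValDivisorSet W p S')
    (hgap : ∀ d v, (d, v) ∈ S' → S.card ≤ v → Even d → d ≤ n → n ≤ d + 1) : BSDp W p :=
  Leaf.bsdp_of_muPartAt_of_generatorCount_of_prop415 hW16 hGr h310 h415 hmod hGZK hL hμ hlam
    (generatorCountGE_of_dvd_localTamagawaNumber (isClassX1_of_classX1 hL.classX1).two_ne hPT
      htors S hSp hcv) hS hgap

end Leaf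

end Summit.BirchSwinnertonDyer.Rank1Residual.X1.GeneratorCountTamagawa

end
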